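import Mathlib
import Summits.KontsevichZagierPeriods.KontsevichZagierPeriods.Theorems.SoloInformedDivisionZeta
import Summits.KontsevichZagierPeriods.KontsevichZagierPeriods.Theorems.SoloInformedKummerBisectionE
import HarnessLib
import HarnessLib.Audit

/-!
# Division by translation V: the translation move for the second kind (solo-informed, s43)

Fifth file of LEMMA XXIX.1 KERNEL.  Part II moved the differential of the FIRST kind along
Jacobi's addition map `T_a` (`u ↦ u + v` in `P`, no correction term).  For the SECOND kind
`e(x) dx = (1 − m x²)κ(x) dx` the same change of variables produces Jacobi's correction:

  `[(a, T_a(b)), e] + [pt, m·a·b·T_a(b)] − [(0,b), e] ∈ relations`,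

i.e. `E(u+v) − E(v) = E(u) − k² sn u sn v sn(u+v)` as an identity of CLASSES in the formal period
ring, obtained from four Kontsevich–Zagier moves: rule (2) along `t ↦ T_a(t)` applied to
`[(0,b), e − m a (t T_a)']` (the integrand identity is part IV,
`soloInformed_addm_secondKind`), rule (1b) splitting off the correction integrand
`m a (t T_a(t))' = m a (T_a + t W_a)`, a null-boundary move, and Newton–Leibniz over the point
for the primitive `m a·t·T_a(t)` on `[0,b]`.

References: C. G. J. Jacobi, *Fundamenta nova* (1829), §§53–55; A. M. Legendre, *Traité des
fonctions elliptiques* I (1825), ch. IX; M. Kontsevich, D. Zagier, *Periods* (2001), §1.2;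
this work (solo-informed s43).
-/

noncomputable section

open MeasureTheory Set Filter
open scoped Classical

open Literature.NumberTheory.Transcendental Literature.NumberTheory.Transcendental.KZ
open Literature.ModelTheory.ExponentialFields

namespace Summit.KontsevichZagierPeriods.KontsevichZagierPeriods.Theorems

/-- **LEMMA XXIX.1-K, the translation move (second kind).**  For real algebraic `0 < m < 1`,
`a ∈ [0,1]`, `b ∈ (0,1)` with the turn condition `b²(1 − m a²) ≤ 1 − a²`, representations
`r = [(0,b), e]`, `r' = [(a, T_a(b)), e]` of the second kind (`e(x) = (1 − m x²)κ(x)`) and the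
algebraic constant `c = m·a·b·T_a(b)`:  `[r'] + [pt, c] − [r] ∈ relations` — Jacobi's addition
theorem for `E` as moves. [Jacobi 1829, §53; this work] -/
theorem soloInformed_addm_translation_moveE {m a b : ℝ} (hm : m ∈ Ioo (0:ℝ) 1)
    (hma : IsAlgebraic ℚ m) (ha : a ∈ Icc (0:ℝ) 1) (haa : IsAlgebraic ℚ a) (hb : b ∈ Ioo (0:ℝ) 1)
    (hba : IsAlgebraic ℚ b) (hturn : b ^ 2 * (1 - m * a ^ 2) ≤ 1 - a ^ 2) (r r' : IntegralRep 1)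
    (hrd : r.domain = {x | x 0 ∈ Ioo (0:ℝ) b})
    (hr'd : r'.domain = {x | x 0 ∈ Ioo a (soloInformedAddm m a b)})
    (hri : EqOn r.integrand
      (fun x => (1 - m * x 0 ^ 2) * ((√(1 - x 0 ^ 2))⁻¹ * (√(1 - m * x 0 ^ 2))⁻¹)) r.domain)
    (hr'i : EqOn r'.integrand
      (fun x => (1 - m * x 0 ^ 2) * ((√(1 - x 0 ^ 2))⁻¹ * (√(1 - m * x 0 ^ 2))⁻¹)) r'.domain)
    {c : ℝ} (hc : IsAlgebraic ℚ c) (hcv : c = m * a * (b * soloInformedAddm m a b)) :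
    of r' + of (IntegralRep.unit.constMul c hc) - of r ∈ relations := by
  have himg := soloInformed_addm_image hm ha hb hturn
  have hLo : IsSemialgebraic ℚ {x : Fin 1 → ℝ | x 0 ∈ Ioo (0:ℝ) b} :=
    (isSemialgebraic_setOf_const_lt_apply isAlgebraic_zero 0).inter
      (isSemialgebraic_setOf_apply_lt_const hba 0)
  -- (i) the correction representation `P = [[0,b], m a (T_a + t W_a)]` and `V = r − P` on `(0,b)`
  obtain ⟨P, hPd, hPi⟩ := soloInformed_exists_addmP_rep hm hma ha haa hb hba
  have hloE : {x : Fin 1 → ℝ | x 0 ∈ Ioo (0:ℝ) b} ⊆ r.domain := fun x hx => by rw [hrd]; exact hx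
  have hloP : {x : Fin 1 → ℝ | x 0 ∈ Ioo (0:ℝ) b} ⊆ P.domain := fun x hx => by
    rw [hPd]; exact ⟨le_of_lt hx.1, le_of_lt hx.2⟩
  obtain ⟨V, hVd, hVi⟩ : ∃ V : IntegralRep 1, V.domain = {x | x 0 ∈ Ioo (0:ℝ) b} ∧
      V.integrand = r.integrand - P.integrand :=
    ⟨⟨_, _, hLo, (r.isSemialgebraicFunOn_integrand.mono hloE hLo).sub_holds
      (P.isSemialgebraicFunOn_integrand.mono hloP hLo),
      (r.integrableOn.mono_set hloE).sub (P.integrableOn.mono_set hloP)⟩, rfl, rfl⟩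
  -- (ii) rule (2) along `t ↦ T_a(t)`: `[V] − [r'] ∈ relations` (the `Z`-addition theorem)
  have h2 : of V - of r' ∈ relations := by
    refine changeOfVariablesRel_subset_relations (soloInformed_lift_mem_changeOfVariablesRel V r'
      (g := soloInformedAddm m a) (g' := soloInformedAddmDeriv m a) (S := Ioo (0:ℝ) b)
      (T := Ioo a (soloInformedAddm m a b)) hVd hr'd ?_ (fun t ht => ?_) ?_ himg fun x hx => ?_)
    · rw [hVd]
      exact soloInformed_addm_lift_sa hm hma ha haa hLo
        fun x hx => ⟨le_of_lt hx.1, (le_of_lt hx.2).trans hb.2.le⟩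
    · exact soloInformed_addm_hasDerivAt hm ha ⟨ht.1, ht.2.trans hb.2⟩
    · exact (soloInformed_addm_strictMonoOn hm ha hb hturn).injOn.mono Ioo_subset_Icc_self
    · have hxS : x 0 ∈ Ioo (0:ℝ) b := by rw [hVd] at hx; exact hx
      have hx1 : x 0 ∈ Ioo (0:ℝ) 1 := ⟨hxS.1, hxS.2.trans hb.2⟩
      have hstrict := soloInformed_addm_strict_of_turn hm ha hturn hxS
      have hmem : soloInformedLift (soloInformedAddm m a) x ∈ r'.domain := by
        rw [hr'd, mem_setOf_eq, ← himg]
        exact ⟨x 0, hxS, rfl⟩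
      rw [hVi, Pi.sub_apply, hri (hloE hxS), hPi, hr'i hmem]
      simp only [soloInformedLift]
      rw [soloInformed_addm_secondKind hm ha hx1 hstrict,
        ← soloInformed_addmDeriv_eq hm ha ⟨hxS.1.le, hx1.2⟩ hstrict.le]
  -- (iii) rule (1b): `r = V + P|` on `(0,b)`
  have h5 : of r - of V - of (P.restrict _ hLo hloP) ∈ relations := by
    refine integrandAddRel_subset_relations ⟨1, r, V, P.restrict _ hLo hloP, by rw [hVd, hrd],
      by rw [IntegralRep.domain_restrict, hrd], fun x _ => ?_, rfl⟩
    simp only [Pi.add_apply, hVi, Pi.sub_apply, IntegralRep.integrand_restrict]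
    ring
  -- (iv) the null boundary `{0, b}` of `P`
  have hvolP : volume (P.domain \ {x : Fin 1 → ℝ | x 0 ∈ Ioo (0:ℝ) b}) = 0 := by
    refine measure_mono_null (fun x hx => ?_) (measure_union_null
      (BallPeeling.volume_setOf_apply_eq_const 1 0 0)
      (BallPeeling.volume_setOf_apply_eq_const 1 0 b))
    rw [hPd] at hx
    have h01 : x 0 ∈ Icc (0:ℝ) b := hx.1
    by_contra hcon
    simp only [mem_union, mem_setOf_eq, not_or] at hcon
    exact hx.2 ⟨lt_of_le_of_ne h01.1 (Ne.symm hcon.1), lt_of_le_of_ne h01.2 hcon.2⟩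
  have h6 := IntegralRep.of_sub_of_restrict_mem_relations P hLo hloP hvolP
  -- (v) Newton–Leibniz over the point for `φ(y) = m a · y · T_a(y)` on `[0,b]`
  have h7 : of P - of (IntegralRep.unit.constMul c hc) ∈ relations := by
    have hC := soloInformed_closedSlab_isSemialgebraic hba
    refine soloInformed_of_sub_unitConstMul_mem_relations P hba hb.1.le hPd
      (fun y => m * a * (y * soloInformedAddm m a y)) ?_ ?_ (fun t ht => ?_) hc ?_
    · rw [hPd]
      refine ((isSemialgebraicFunOn_const_of_isAlgebraic hC (hma.mul haa)).mul_holds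
        ((isSemialgebraicFunOn_aeval hC (MvPolynomial.X 0)).mul_holds
          (soloInformed_addm_fun_sa hm hma ha haa hC
            fun x hx => ⟨hx.1, hx.2.trans hb.2.le⟩))).congr fun x _ => ?_
      simp only [Pi.mul_apply, MvPolynomial.aeval_X]
    · exact continuousOn_const.mul (continuousOn_id.mul
        ((soloInformed_addm_continuousOn hm ha).mono (Icc_subset_Icc_right hb.2.le)))
    · have ht1 : t ∈ Ioo (0:ℝ) 1 := ⟨ht.1, ht.2.trans hb.2⟩
      have hPt : P.integrand (fun _ => t) =
          m * a * (soloInformedAddm m a t + t * soloInformedAddmW m a t) := hPi _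
      have hd : HasDerivAt (fun y => m * a * (y * soloInformedAddm m a y))
          (m * a * (1 * soloInformedAddm m a t + t * soloInformedAddmDeriv m a t)) t :=
        ((hasDerivAt_id' t).mul (soloInformed_addm_hasDerivAt hm ha ht1)).const_mul (m * a)
      rw [one_mul] at hd
      rw [hPt, ← soloInformed_addmDeriv_eq hm ha ⟨ht.1.le, ht1.2⟩
        (soloInformed_addm_strict_of_turn hm ha hturn ht).le]
      exact hd
    · simp only [hcv, zero_mul, mul_zero, sub_zero]
  -- (vi) combine
  have := relations.sub_mem (relations.sub_mem h6 h7) (relations.add_mem h2 h5)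
  convert this using 1
  abel

end Summit.KontsevichZagierPeriods.KontsevichZagierPeriods.Theorems

end
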